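import Literature.AlgebraicGeometry.Motives.KunnethComponentsOfAlgebraicClasses
import Literature.AlgebraicGeometry.Motives.KatzMessingProjectorsIndependence
import Literature.AlgebraicGeometry.Motives.KatzMessingRationalCharpoly
import Literature.AlgebraicGeometry.Motives.NumericallyTrivialCorrespondencesKunnethCases
import Literature.AlgebraicGeometry.Motives.FrobeniusMorphism
import HarnessLib

/-!
# The Künneth standard conjecture over a finite field, in the tree's named hypotheses

The finite-field results of this topic (`KatzMessingKunnethProjectors`, `KatzMessingRationalCharpoly`,
`KatzMessingProjectorsIndependence`, `NumericallyTrivialCorrespondencesKunnethCases`,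
`KunnethComponentsOfAlgebraicClasses`) are stated for one smooth projective `X` with the geometric
Frobenius acting on `H•(X)` through SOME `k`-endomorphism `φ` and with `E.WeilRiemannHypothesisFor X n`.
This file restates them in the two hypotheses the tree uses for a Galois Weil cohomology theory `E`
over the finite field `k` as a whole:

* **(D)** Frobenius compatibility — the geometric Frobenius acts on every `Hᵃ(X)`, `X` smooth
  projective, as the pull-back by the `q`-Frobenius `k`-endomorphism `F_{X/k} = frobeniusOver X`
  (Deligne 1974 (1.15); the hypothesis `hρ` of
  `GaloisWeilCohomology.hasLefschetzTraceFormula_of_frobeniusOver`);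
* **Deligne's theorem (1.6) for `E`** — `Literature.NumberTheory.LFunctions.DeligneWeilIStatement E`:
  the Riemann hypothesis `E.WeilRiemannHypothesisFor X n` for every smooth projective `X`.

Under (D) and (1.6): the Künneth standard conjecture `E.KunnethStandardConjecture` (Katz–Messing
Thm. 2 (1); Kahn 2020 Thm. 6.33 "If `k` is finite, the Künneth projectors are algebraic for all
`X ∈ V(k)`"), Jannsen's Cor. 1 for every `X` (Remark 1: "for all `X` if `k` is … a finite field"),
Künneth components of algebraic classes on every product are algebraic, the characteristic
polynomials of all endomorphisms on all `Hⁱ(X)` are rational, and — for two such theories both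
satisfying the Lefschetz trace formula with `χ(φ) = q` — common Künneth-projector polynomials.

Theorems only; no new definitions.

## References

* [KatzMessing1974] N. M. Katz, W. Messing, Invent. Math. 23 (1974), Thm. 2.
* [Kahn2020] B. Kahn, *Zeta and L-functions of varieties and motives* (2020), §6.9 Thm. 6.33.
* [Deligne1974] P. Deligne, *La conjecture de Weil. I*, Publ. Math. IHÉS 43 (1974), (1.15), Thm. (1.6).
* [Jannsen1992Motives] U. Jannsen, Invent. Math. 107 (1992), Cor. 1 and Remark 1.
-/

universe u v w

open CategoryTheory AlgebraicGeometry MonoidalCategory CartesianMonoidalCategory Polynomial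
open Literature.NumberTheory.LFunctions (DeligneWeilIStatement)

noncomputable section

namespace Literature.AlgebraicGeometry.Motives

namespace GaloisWeilCohomology

variable {k : Type u} [Field k] [Finite k] {K : Type v} [Field K] [CharZero K]
  {χ : Field.absoluteGaloisGroup k →* Kˣ} (E : GaloisWeilCohomology k K χ)

/-- Under (D), the Frobenius endomorphism of `Hⁱ(X)` is the pull-back by `F_{X/k}`.
[cite: Deligne1974, (1.15) p. 279] -/
theorem frobAction_eq_pullback_frobeniusOver
    (hD : ∀ ⦃n : ℕ⦄ ⦃X : SchemeOver k⦄, IsSmoothProjective n X → ∀ a : ℕ,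
      E.ρ X a (geomFrob k) = E.pullback (frobeniusOver X) a)
    {n : ℕ} {X : SchemeOver k} (hX : IsSmoothProjective n X) (i : ℕ) :
    E.frobAction X i = E.pullback (frobeniusOver X) i := by
  rw [E.frobAction_def, hD hX i]

/-- **Katz–Messing Thm. 2 (1) for the theory `E`: the Künneth standard conjecture over a finite
field.** If `E` satisfies (D) and Deligne's theorem (1.6), then `C(X)` holds for every smooth
projective `X` over `k` (Kahn 2020 Thm. 6.33: "If `k` is finite, the Künneth projectors are
algebraic for all `X ∈ V(k)`"). [cite: KatzMessing1974, Thm. 2 (1)] [cite: Kahn2020, §6.9 Thm. 6.33] -/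
theorem kunnethStandardConjecture_of_deligneWeilIStatement
    (hD : ∀ ⦃n : ℕ⦄ ⦃X : SchemeOver k⦄, IsSmoothProjective n X → ∀ a : ℕ,
      E.ρ X a (geomFrob k) = E.pullback (frobeniusOver X) a)
    (hW : DeligneWeilIStatement E) : E.KunnethStandardConjecture :=
  E.kunnethStandardConjecture_of_weilRiemannHypothesisFor
    (fun _ X hX ↦ ⟨frobeniusOver X, E.frobAction_eq_pullback_frobeniusOver hD hX⟩) hW

variable {n m : ℕ} {X Z : SchemeOver k}

/-- `C(X)` for each `X`, under (D) and (1.6). [cite: KatzMessing1974, Thm. 2 (1)] -/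
theorem standardConjectureC_of_deligneWeilIStatement
    (hD : ∀ ⦃n : ℕ⦄ ⦃X : SchemeOver k⦄, IsSmoothProjective n X → ∀ a : ℕ,
      E.ρ X a (geomFrob k) = E.pullback (frobeniusOver X) a)
    (hW : DeligneWeilIStatement E) (hX : IsSmoothProjective n X) : E.StandardConjectureC n X :=
  E.kunnethStandardConjecture_of_deligneWeilIStatement hD hW hX

/-- The Künneth projectors of `X` are rational polynomials in `F = F_{X/k}*`, under (D) and (1.6).
[cite: KatzMessing1974, Thm. 2 (1)] [cite: Kahn2020, §6.9 Thm. 6.33] -/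
theorem exists_isDegreeProjector_eq_aeval_frobAction_of_deligneWeilIStatement
    (hD : ∀ ⦃n : ℕ⦄ ⦃X : SchemeOver k⦄, IsSmoothProjective n X → ∀ a : ℕ,
      E.ρ X a (geomFrob k) = E.pullback (frobeniusOver X) a)
    (hW : DeligneWeilIStatement E) (hX : IsSmoothProjective n X) (i : ℕ) :
    ∃ (Q : ℚ[X]) (T : E.GradedOp X X), E.IsAlgebraicGradedOp n n T ∧ E.IsDegreeProjector X i T ∧
      (∀ a b : ℕ, a ≠ b → T a b = 0) ∧
        ∀ j : ℕ, T j j = aeval (E.pullback (frobeniusOver X) j) (Q.map (algebraMap ℚ K)) := by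
  obtain ⟨Q, T, hT, hdeg, hdiag, h⟩ := E.exists_isDegreeProjector_eq_aeval_frobAction hX
    (frobeniusOver X) (E.frobAction_eq_pullback_frobeniusOver hD hX) (hW hX) i
  exact ⟨Q, T, hT, hdeg, hdiag, fun j ↦ by rw [h j, E.frobAction_eq_pullback_frobeniusOver hD hX]⟩

/-- **Jannsen Cor. 1 for every smooth projective `X` over a finite field** (Remark 1: "for all `X`
if `k` is … a finite field ([KM])"), under (D) and (1.6): the numerically trivial degree-`0`
correspondences form the Jacobson radical of `Bⁿ(X × X)_K`. [cite: Jannsen1992Motives, Cor. 1 and Remark 1 (p. 451)]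
[cite: KatzMessing1974, Thm. 2 (1)] -/
theorem numericallyTrivial_eq_jacobson_of_deligneWeilIStatement
    (hD : ∀ ⦃n : ℕ⦄ ⦃X : SchemeOver k⦄, IsSmoothProjective n X → ∀ a : ℕ,
      E.ρ X a (geomFrob k) = E.pullback (frobeniusOver X) a)
    (hW : DeligneWeilIStatement E) (hX : IsSmoothProjective n X) :
    (E.numericallyTrivial n X).asIdeal = Ring.jacobson (E.homCorrAlgebra n X) :=
  E.numericallyTrivial_eq_jacobson hX (E.standardConjectureC_of_deligneWeilIStatement hD hW hX)

/-- … and this ideal is nilpotent. [cite: Jannsen1992Motives, Cor. 1 and Remark 1 (p. 451)] -/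
theorem isNilpotent_numericallyTrivial_of_deligneWeilIStatement
    (hD : ∀ ⦃n : ℕ⦄ ⦃X : SchemeOver k⦄, IsSmoothProjective n X → ∀ a : ℕ,
      E.ρ X a (geomFrob k) = E.pullback (frobeniusOver X) a)
    (hW : DeligneWeilIStatement E) (hX : IsSmoothProjective n X) :
    IsNilpotent (E.numericallyTrivial n X).asIdeal :=
  E.isNilpotent_numericallyTrivial hX (E.standardConjectureC_of_deligneWeilIStatement hD hW hX)

/-- **Künneth components of algebraic classes on every product `X × Z` over a finite field are
algebraic**, under (D) and (1.6). [cite: KatzMessing1974, Thm. 2 (1)] [cite: Kahn2020, §6.9 Thm. 6.33 and Lemma 6.30 (3)] -/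
theorem extTensor_kunnethComponent_mem_ratAlgebraicClasses_of_deligneWeilIStatement
    (hD : ∀ ⦃n : ℕ⦄ ⦃X : SchemeOver k⦄, IsSmoothProjective n X → ∀ a : ℕ,
      E.ρ X a (geomFrob k) = E.pullback (frobeniusOver X) a)
    (hW : DeligneWeilIStatement E) (hX : IsSmoothProjective n X) (hZ : IsSmoothProjective m Z)
    {a b c : ℕ} (h : a + b = 2 * c) {z : E.obj (X ⊗ Z) (2 * c)}
    (hz : z ∈ E.ratAlgebraicClasses (X ⊗ Z) c) :
    E.extTensor h (E.kunnethComponent hX hZ a b h z) ∈ E.ratAlgebraicClasses (X ⊗ Z) c :=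
  E.extTensor_kunnethComponent_mem_ratAlgebraicClasses_of_standardConjectureC hX hZ
    (E.standardConjectureC_of_deligneWeilIStatement hD hW hX)
    (E.standardConjectureC_of_deligneWeilIStatement hD hW hZ) h hz

/-- **The characteristic polynomial of every endomorphism `g` of `X` on every `Hⁱ(X)` is rational**,
under (D) and (1.6) (Katz–Messing Thm. 2 (2), rational form). [cite: KatzMessing1974, Thm. 2 (2)] -/
theorem exists_charpoly_pullback_eq_map_of_deligneWeilIStatement
    (hD : ∀ ⦃n : ℕ⦄ ⦃X : SchemeOver k⦄, IsSmoothProjective n X → ∀ a : ℕ,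
      E.ρ X a (geomFrob k) = E.pullback (frobeniusOver X) a)
    (hW : DeligneWeilIStatement E) (hX : IsSmoothProjective n X) (g : X ⟶ X) (i : ℕ) :
    ∃ P : ℚ[X], (haveI := E.finite_obj hX i; (E.pullback g i).charpoly) = P.map (algebraMap ℚ K) :=
  E.exists_charpoly_pullback_eq_map_of_weilRiemannHypothesisFor hX (frobeniusOver X)
    (E.frobAction_eq_pullback_frobeniusOver hD hX) (hW hX) g i

/-- Every pull-back `g* | Hⁱ(X)` is an algebraic operator, under (D) and (1.6). [cite: KatzMessing1974, Thm. 2] -/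
theorem isAlgebraicOperator_pullback_of_deligneWeilIStatement
    (hD : ∀ ⦃n : ℕ⦄ ⦃X : SchemeOver k⦄, IsSmoothProjective n X → ∀ a : ℕ,
      E.ρ X a (geomFrob k) = E.pullback (frobeniusOver X) a)
    (hW : DeligneWeilIStatement E) (hX : IsSmoothProjective n X) (g : X ⟶ X) (i : ℕ) :
    E.IsAlgebraicOperator n n (E.pullback g i) :=
  E.isAlgebraicOperator_pullback_of_weilRiemannHypothesisFor hX (frobeniusOver X)
    (E.frobAction_eq_pullback_frobeniusOver hD hX) (hW hX) g i

/-- **Independence of the theory** (Kahn 2020 Thm. 6.33, second half): for two Galois Weil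
cohomology theories `E`, `E'` over `k` with the Lefschetz trace formula, `χ(φ) = q`, (D) and (1.6),
and every smooth projective `X`, one family `Qᵢ ∈ ℚ[t]` gives the Künneth projectors
`πⁱ = Qᵢ(F_{X/k}*)` in both theories. [cite: KatzMessing1974, Thm. 2 (1)] [cite: Kahn2020, §6.9 Thm. 6.33]
[cite: Deligne1974, Thm. (1.6)] -/
theorem exists_common_kunnethProjector_polynomials_of_deligneWeilIStatement
    {K' : Type w} [Field K'] [CharZero K'] {χ' : Field.absoluteGaloisGroup k →* K'ˣ}
    (E' : GaloisWeilCohomology k K' χ')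
    (hE : E.HasLefschetzTraceFormula) (hχ : (χ (arithFrob k) : K) = Nat.card k)
    (hE' : E'.HasLefschetzTraceFormula) (hχ' : (χ' (arithFrob k) : K') = Nat.card k)
    (hD : ∀ ⦃n : ℕ⦄ ⦃X : SchemeOver k⦄, IsSmoothProjective n X → ∀ a : ℕ,
      E.ρ X a (geomFrob k) = E.pullback (frobeniusOver X) a)
    (hD' : ∀ ⦃n : ℕ⦄ ⦃X : SchemeOver k⦄, IsSmoothProjective n X → ∀ a : ℕ,
      E'.ρ X a (geomFrob k) = E'.pullback (frobeniusOver X) a)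
    (hW : DeligneWeilIStatement E) (hW' : DeligneWeilIStatement E') (hX : IsSmoothProjective n X) :
    ∃ Q : ℕ → ℚ[X], ∀ i : ℕ,
      (∃ T : E.GradedOp X X, E.IsAlgebraicGradedOp n n T ∧ E.IsDegreeProjector X i T ∧
        (∀ a b : ℕ, a ≠ b → T a b = 0) ∧
          ∀ j : ℕ, T j j = aeval (E.pullback (frobeniusOver X) j) ((Q i).map (algebraMap ℚ K))) ∧
      (∃ T' : E'.GradedOp X X, E'.IsAlgebraicGradedOp n n T' ∧ E'.IsDegreeProjector X i T' ∧
        (∀ a b : ℕ, a ≠ b → T' a b = 0) ∧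
          ∀ j : ℕ, T' j j = aeval (E'.pullback (frobeniusOver X) j) ((Q i).map (algebraMap ℚ K'))) := by
  obtain ⟨Q, hQ⟩ := E.exists_common_kunnethProjector_polynomials E' hE hχ hE' hχ' hX (frobeniusOver X)
    (E.frobAction_eq_pullback_frobeniusOver hD hX) (frobeniusOver X)
    (E'.frobAction_eq_pullback_frobeniusOver hD' hX) (hW hX) (hW' hX)
  refine ⟨Q, fun i ↦ ?_⟩
  obtain ⟨⟨T, hT, hdeg, hdiag, h⟩, ⟨T', hT', hdeg', hdiag', h'⟩⟩ := hQ i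
  exact ⟨⟨T, hT, hdeg, hdiag, fun j ↦ by rw [h j, E.frobAction_eq_pullback_frobeniusOver hD hX]⟩,
    ⟨T', hT', hdeg', hdiag', fun j ↦ by rw [h' j, E'.frobAction_eq_pullback_frobeniusOver hD' hX]⟩⟩

end GaloisWeilCohomology

end Literature.AlgebraicGeometry.Motives

end
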